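import Summits.QuantumFields.YangMills.Theorems.BalabanUVNodesN16AtRRec13
import Summits.QuantumFields.YangMills.Theorems.BalabanUVNodesN16HolderSlotWindow

/-!
# Route «BalabanUVNodes», cluster K4 «SpineRates» — node N16 = NE3: THE N16 LINES AT NODE 00's STAGE-13 RATE HOMES — the exponent-β stub `S_N16Holder β` at
# `RRec₁₃On 𝔯 Rg` ∕ `RRec₁₃ 𝔯` (master faces, constant layers, N21's β-face, the `β ≤ 1` weakening), and THE N16 LINE at RR-1's NE3 object of record with WINDOWED
# letters in the LINEAR currency, at the Hölder exponent of record (`S_N16`, β = 1) and at a printed exponent `β ∈ [0, 1]` (`S_N16Holder β`) — `hpin`-generic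

Cell `pub-ymgap`, seat `pub-ymgap-dag-n16-e` (R134 acceleration seat (a), strategy s2 = BY-NAME KNIT at the record; HUMAN RULING D-0062; chair R424 venue),
generation 5, module 20 (THEOREMS ONLY, 0 `def`, 0 `sorry`, standard axioms).  `bears_on: R4∕N16 · K1‴ StabilityBAtRecordR13e (stmt-QuantumFields-19910, the N16 storey's lane per the KEY TABLE
WORDS-133) · K3‴ SpineGivenEndpointR13 (stmt-QuantumFields-19912)`.  The 12 ↦ 13 TOKEN TWIN of this seat's Stage-12 files 14 `…N16SlotWindowReading` (p480498), 15 `…N16HolderAtRecord12` (p482004), 17 §3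
`…N16SlotWindowLinear` (p484035) and 18 §1∕§3 `…N16HolderSlotWindow` (p485315), consolidated by topic, with the named Stage-12 reading `readingOfRecord₁₂ …` replaced by a
PIN HYPOTHESIS `hpin : (𝔯.lit F θ hP g₀ os).ne3 k = ne3ConstLayerOfRecord₁₁ F N (ℓ F)` (at the (T-RATE) Stage-13 reading of record it is `fun … => rfl`).  Imports module 19
`…N16AtRRec13` (the `S_N16` kit at the ₁₃ homes; through it the (T-RATE) homes, RR-2's key, `Node00/Record13` v1.1) and file 18 (through it dag-n16-c's (E1)∕(E2)
`…N16HolderRegime` ∕ `…N16HolderLeafSlot` — `InEndRegimeH`, `radiusOfRecordH`, `constOfRecordH`, `LeafSlotHolder`, the closer `n16HolderAt_of_inEndRegimeH_leafSlotHolder` —,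
`…N16HolderDefs` (`CovRootHolder`, `N16HolderAt`, `S_N16Holder`, `s_N16Holder_of_s_N16`), and the STAGE-FREE per-family window lemmas
`N16SlotWindowLinear.inEndRegime_and_leafSlot_ofRecord_of_window_linear` ∕ `N16HolderSlotWindow.inEndRegimeH_and_leafSlotHolder_ofRecord_of_window_linear`, reused BY NAME).
Restates nothing.

WHY.  See module 19: the Record-13 re-key (director-ym №125; def-T p486037 ∕ p488788; RR-2's key; the (T-RATE) ₁₃ homes; plan rev 16∕17 K0‴–K3‴) moves the HOME'S NAME under
N16's two consumer-facing lines — dag-n27-c's ∕ dag-n21-d's `h16` at the reading of record with windowed letters (file 17 §3, ref-B READ-445's linear recipe) and its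
exponent-β twin over dag-n16-c's β-kit (file 18 §3; LOCATED-N16-HÖLDER-PIN, R-β unruled: `S_N16 ↦ S_N16Holder β` is a re-point BY NAME on either ruling).  Every CONTENT
lemma is home-free and already in the tree; this module re-seats the one-application compositions at `RRec₁₃On` ∕ `RRec₁₃`.

CONTENT.
§1 `S_N16Holder β` AT THE ₁₃ HOMES — `s_N16Holder_rRec₁₃On_iff` (guarded θ-form, the (T-RATE) generic `rateStub_rRec₁₃On_iff`), `s_N16Holder_rRec₁₃_iff`,
   `s_N16Holder_rRec₁₃On_anti`, `s_N16Holder_rRec₁₃_of_rRec₁₃On_true`, the `β ≤ 1` WEAKENING `s_N16Holder_rRec₁₃On_of_s_N16` ∕ `s_N16Holder_rRec₁₃_of_s_N16`.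
§2 CONSTANT NE3 LAYERS — `s_N16Holder_rRec₁₃On_iff_of_constLayer`, `s_N16Holder_rRec₁₃_iff_of_constLayer`, and the Holder-leaf closers at ONE bundle per family
   `s_N16Holder_rRec₁₃On_of_constLayer_leafSlotHolder` ∕ `s_N16Holder_rRec₁₃_of_constLayer_leafSlotHolder` (`0 ≤ β ≤ 1`).
§3 AT RR-1's NE3 OBJECT OF RECORD (`hpin`-generic) — `s_N16Holder_rRec₁₃On_iff_ofRecord`, `n16HolderAt_of_s_N16Holder_rRec₁₃On_ofRecord`, ★ N21's β-FACE
   `covRootHolder_rRec₁₃On_ofRecord` (the β-root `CovRootHolder` at RR-1's period `2·L^m`, letters `ℓ F`, data `ne3DomOfRecord₁₁ F N 0 0` — what dag-n21-d's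
   `…N21HolderWidth` reads), `s_N16Holder_rRec₁₃On_ofRecord_of_rRec₁₃` (the two homes agree), `s_N16Holder_rRec₁₃On_ofRecord_of_s_N16` (`β ≤ 1`, `0 ≤ (ℓ F).Λ₂'`).
§4 ★ THE N16 LINE AT ₁₃, LINEAR CURRENCY (β = 1, the stub of record) — `s_N16_rRec₁₃On_ofRecord_of_window_linear` ∕ `s_N16_rRec₁₃_ofRecord_of_window_linear`: N05's
   `Thm4Body` ∕ `Prop3Body` on the univ sub-family of `zdGF3 (M_N ℂ) F.L 1 (len F)` and N07's `LeafH3sup` ONCE per guarded family ⇒ `S_N16 (RRec₁₃On 𝔯 Rg)` ∕ `S_N16 (RRec₁₃ 𝔯)`;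
   every other hypothesis is a DISPLAYED letter line (N05's eleven-line window at `c₁'`, the averaging letter `α` under five bounds, `ε < α ≤ Λ₁∕(1770·B+1)`,
   `177·α·(B_h+B) ≤ Λ₂'`, N07's `0 ≤ b' ≤ α∕2048`, `0 ≤ c' ≤ α∕24`, THE END's tolerance `Λ₁ ≤ r_F`, `0 ≤ b ≤ ε∕2`, `Cof g ≤ C`).
§5 ★ THE N16 LINE AT ₁₃ AT EXPONENT `β ∈ [0, 1]` — `s_N16Holder_rRec₁₃On_ofRecord_of_window_linear` ∕ `s_N16Holder_rRec₁₃_ofRecord_of_window_linear` (N05's family at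
   `zdGF3 … F.L β (len F)`, (E1)'s β-uniform thresholds `radiusOfRecordH` ∕ `constOfRecordH`).
The letter lines of §4 ∕ §5 are JOINTLY SATISFIABLE with the proviso and N21's numerals at every family (files 13 ∕ 18: `exists_window_letters_numerals(_H)`, stage-free — not
repeated).

HONEST FRAMING.  Kernel bookkeeping by name; no estimate; N05's `Thm4Body` ∕ `Prop3Body` ([Balaban1985RegularSpaces] Thm 4 ∕ Prop 3 as typed by n05-a, all-torus sub-family)
and N07's `LeafH3sup` ([Balaban1985Variational] Thm 1 (8)+(10) TYPE) are HYPOTHESES asserted for no family; `S_N16Holder β` is dag-n16-c's CANDIDATE stub shape for the located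
repair R-β — the statement edit is the planner's ∕ director's (UNRULED), nothing of record is edited; the reading `𝔯` is a PARAMETER pinned only through `hpin`; no admissible
Stage-13 tuple with provisos is claimed to exist (K0‴ OPEN); **N16 ∕ NE3 is NOT discharged**; count-neutral; one finite four-torus at fixed ε — NOT ℝ⁴, NOT infinite volume, NOT
OS, NOT a mass gap, NOT Clay.
-/

set_option autoImplicit false

open scoped BigOperators Matrix Matrix.Norms.L2Operator
open NormedSpace

namespace Summit.QuantumFields.YangMills.BalabanUVNodes.N16AtRRec13Lines

open Literature.MathematicalPhysics.QuantumFieldTheory.Balaban1983to89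
open Literature.MathematicalPhysics.QuantumFieldTheory.Balaban1983to89.T4Continuum (T4Family ULoop)
open B7Prop1Explicit B7Prop2Explicit
open B7Prop3Flat (c3)
open B8LeafModelZd (ZdIdx)
open B8LeafModelZd3 (zdGF3)
open Node00 (IsDatumOfRecord₁₃C Stage13Params NE3Objects₁₁ NE3Letters₁₁ NE2Objects₁₁ ne3LOfRecord₁₁ ne3ConstLayerOfRecord₁₁ ne3NperOfRecord₁₁ ne3DomOfRecord₁₁
  one_le_ne3NperOfRecord₁₁)
open Summit.QuantumFields.BalabanUV.T4Continuum
open MinimalActionRate (sfClass)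
open BlockAverageCurrent (curConst)
open NE3RightInverseSupLetters (frameC)
open NE3.LeafIndexSockets (LeafH3sup)
open YMDAG.UVSplit (Datum NE3Carriers NE1pCarriers RateCarriers S_N16 ne3OfRecord₁₁ RateReading₁₃ RRec₁₃ RRec₁₃On rateStub_rRec₁₃On_iff rRec₁₃On_mono
  rRec₁₃_le_rRec₁₃On_true rRec₁₃On_self)
open Summit.QuantumFields.YangMills.BalabanUVNodes.N16Regime (InEndRegime radiusOfRecord constOfRecord)
open Summit.QuantumFields.YangMills.BalabanUVNodes.N16LeafSlot (LeafSlot)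
open Summit.QuantumFields.YangMills.BalabanUVNodes.N16HolderDefs (CovRootHolder N16HolderAt S_N16Holder s_N16Holder_of_s_N16)
open Summit.QuantumFields.YangMills.BalabanUVNodes.N16HolderRegime (InEndRegimeH radiusOfRecordH constOfRecordH)
open Summit.QuantumFields.YangMills.BalabanUVNodes.N16HolderLeafSlot (LeafSlotHolder n16HolderAt_of_inEndRegimeH_leafSlotHolder)
open Summit.QuantumFields.YangMills.BalabanUVNodes.N16SlotWindowLinear (inEndRegime_and_leafSlot_ofRecord_of_window_linear)
open Summit.QuantumFields.YangMills.BalabanUVNodes.N16HolderSlotWindow (inEndRegimeH_and_leafSlotHolder_ofRecord_of_window_linear)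
open Summit.QuantumFields.YangMills.BalabanUVNodes.N16AtRRec13 (s_N16_rRec₁₃On_ofRecord_of_leafSlot s_N16_rRec₁₃_of_constLayer_leafSlot)

noncomputable section

variable {N : ℕ} [NeZero N] (β : ℝ) (𝔯 : RateReading₁₃ N) (Rg : (F : T4Family) → Stage13Params F N → Prop)

/-! ## §1 Master faces, regime monotonicity, the `β ≤ 1` weakening -/

/-- **`S_N16Holder β` AT THE REGIME-RESTRICTED HOME — GUARDED θ-FORM**: `S_N16Holder β (RRec₁₃On 𝔯 Rg)` iff for every family, every admissible Stage-13 tuple `θ` with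
provisos `hP` in `Rg`, every `(g₀, os)` and run length `k`, `N16HolderAt (ne3OfRecord₁₁ F ((𝔯.lit F θ hP g₀ os).ne3 k)) β` (dag-n22-e's `rateStub_rRec₁₃On_iff`). [folklore] -/
theorem s_N16Holder_rRec₁₃On_iff :
    S_N16Holder β (RRec₁₃On 𝔯 Rg) ↔ ∀ (F : T4Family) (θ : Stage13Params F N) (hP : θ.Provisos₁₃ F N), Rg F θ → θ.Admissible F N →
      ∀ (g₀ : ℕ → ℝ) (os : List (ULoop F)) (k : ℕ), N16HolderAt (ne3OfRecord₁₁ F ((𝔯.lit F θ hP g₀ os).ne3 k)) β :=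
  rateStub_rRec₁₃On_iff 𝔯 Rg fun _ R => N16HolderAt R.ne3 β

/-- **`S_N16Holder β` AT THE CANONICAL HOME**: iff for every family, datum with its Stage-13 key `h`, `(g₀, os)` and run length `k`,
`N16HolderAt (ne3OfRecord₁₁ F ((𝔯.lit F h.params h.provisos g₀ os).ne3 k)) β`. [folklore] -/
theorem s_N16Holder_rRec₁₃_iff :
    S_N16Holder β (RRec₁₃ 𝔯) ↔ ∀ (F : T4Family) (D : Datum F N) (h : IsDatumOfRecord₁₃C F N D) (g₀ : ℕ → ℝ) (os : List (ULoop F)) (k : ℕ),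
      N16HolderAt (ne3OfRecord₁₁ F ((𝔯.lit F h.params h.provisos g₀ os).ne3 k)) β := by
  constructor
  · intro hS F D h g₀ os k
    exact hS F D g₀ os _ ⟨h, k, rfl⟩
  · rintro hS F D g₀ os R ⟨h, k, rfl⟩
    exact hS F D h g₀ os k

/-- **ANTITONE IN THE REGIME**: a larger regime asks more. [folklore] -/
theorem s_N16Holder_rRec₁₃On_anti {Rg Rg' : (F : T4Family) → Stage13Params F N → Prop} (h : ∀ F θ, Rg F θ → Rg' F θ) (hS : S_N16Holder β (RRec₁₃On 𝔯 Rg')) :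
    S_N16Holder β (RRec₁₃On 𝔯 Rg) :=
  fun F D g₀ os R hR => hS F D g₀ os R (rRec₁₃On_mono 𝔯 h hR)

/-- **THE TRIVIAL REGIME COVERS THE CANONICAL HOME**. [folklore] -/
theorem s_N16Holder_rRec₁₃_of_rRec₁₃On_true (hS : S_N16Holder β (RRec₁₃On 𝔯 fun _ _ => True)) : S_N16Holder β (RRec₁₃ 𝔯) :=
  fun F D g₀ os R hR => hS F D g₀ os R (rRec₁₃_le_rRec₁₃On_true 𝔯 hR)

/-- **THE `β ≤ 1` WEAKENING AT THE REGIME-RESTRICTED HOME**: the stub of record implies the candidate stub for every `β ≤ 1`, provided the reading's NE3 layers carry a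
non-negative Hölder letter (`N16HolderDefs.s_N16Holder_of_s_N16`; the block factor `F.L ≥ 2` is the family's). [folklore] -/
theorem s_N16Holder_rRec₁₃On_of_s_N16 (hβ : β ≤ 1)
    (hΛ : ∀ (F : T4Family) (θ : Stage13Params F N) (hP : θ.Provisos₁₃ F N) (g₀ : ℕ → ℝ) (os : List (ULoop F)) (k : ℕ), 0 ≤ ((𝔯.lit F θ hP g₀ os).ne3 k).Λ₂')
    (hS : S_N16 (RRec₁₃On 𝔯 Rg)) : S_N16Holder β (RRec₁₃On 𝔯 Rg) :=
  s_N16Holder_of_s_N16 hS hβ fun F D g₀ os R hR => by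
    obtain ⟨θ, hP, -, -, -, k, rfl⟩ := hR
    exact ⟨le_trans one_le_two (HistoryFlow.two_le_L F), hΛ F θ hP g₀ os k⟩

/-- **THE `β ≤ 1` WEAKENING AT THE CANONICAL HOME**. [folklore] -/
theorem s_N16Holder_rRec₁₃_of_s_N16 (hβ : β ≤ 1)
    (hΛ : ∀ (F : T4Family) (θ : Stage13Params F N) (hP : θ.Provisos₁₃ F N) (g₀ : ℕ → ℝ) (os : List (ULoop F)) (k : ℕ), 0 ≤ ((𝔯.lit F θ hP g₀ os).ne3 k).Λ₂')
    (hS : S_N16 (RRec₁₃ 𝔯)) : S_N16Holder β (RRec₁₃ 𝔯) :=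
  s_N16Holder_of_s_N16 hS hβ fun F D g₀ os R hR => by
    obtain ⟨h, k, rfl⟩ := hR
    exact ⟨le_trans one_le_two (HistoryFlow.two_le_L F), hΛ F h.params h.provisos g₀ os k⟩

/-! ## §2 Readings with a constant NE3 layer -/

section ConstLayer

variable (o : T4Family → NE3Objects₁₁ N)

/-- **FOR A READING WHOSE NE3 COMPONENT IS CONSTANTLY `o F`, `S_N16Holder β (RRec₁₃On 𝔯 Rg)` IS ONE `N16HolderAt … β` PER GUARDED FAMILY.** [folklore] -/
theorem s_N16Holder_rRec₁₃On_iff_of_constLayer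
    (hpin : ∀ (F : T4Family) (θ : Stage13Params F N) (hP : θ.Provisos₁₃ F N) (g₀ : ℕ → ℝ) (os : List (ULoop F)) (k : ℕ), (𝔯.lit F θ hP g₀ os).ne3 k = o F) :
    S_N16Holder β (RRec₁₃On 𝔯 Rg) ↔ ∀ (F : T4Family), (∃ θ : Stage13Params F N, θ.Provisos₁₃ F N ∧ Rg F θ ∧ θ.Admissible F N) →
      N16HolderAt (ne3OfRecord₁₁ F (o F)) β := by
  rw [s_N16Holder_rRec₁₃On_iff]
  constructor
  · rintro h F ⟨θ, hP, hRg, hθ⟩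
    have h' := h F θ hP hRg hθ (fun _ => 0) [] 0
    rwa [hpin] at h'
  · intro h F θ hP hRg hθ g₀ os k
    rw [hpin]
    exact h F ⟨θ, hP, hRg, hθ⟩

/-- **THE SAME AT THE CANONICAL HOME**: one `N16HolderAt … β` per family carrying a Stage-13 datum of record. [folklore] -/
theorem s_N16Holder_rRec₁₃_iff_of_constLayer
    (hpin : ∀ (F : T4Family) (θ : Stage13Params F N) (hP : θ.Provisos₁₃ F N) (g₀ : ℕ → ℝ) (os : List (ULoop F)) (k : ℕ), (𝔯.lit F θ hP g₀ os).ne3 k = o F) :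
    S_N16Holder β (RRec₁₃ 𝔯) ↔ ∀ (F : T4Family), (∃ D : Datum F N, IsDatumOfRecord₁₃C F N D) → N16HolderAt (ne3OfRecord₁₁ F (o F)) β := by
  rw [s_N16Holder_rRec₁₃_iff]
  constructor
  · rintro h F ⟨D, hD⟩
    have h' := h F D hD (fun _ => 0) [] 0
    rwa [hpin] at h'
  · intro h F D hD g₀ os k
    rw [hpin]
    exact h F ⟨D, hD⟩

end ConstLayer

/-! ## §2b The Holder-leaf closers at ONE bundle per family (file 18 §1, 12 ↦ 13) -/

section ConstLayerLeaf

variable (hβ0 : 0 ≤ β) (hβ1 : β ≤ 1) (o : T4Family → NE3Objects₁₁ N)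
include hβ0 hβ1

/-- **THE KNIT AT A CONSTANT LAYER, HOLDER LEAF FORM, REGIME-RESTRICTED HOME** (`0 ≤ β ≤ 1`): for a reading whose NE3 component is constantly `o F`, the H-proviso
`InEndRegimeH` and the Holder slot `LeafSlotHolder · β` at the ONE bundle `ne3OfRecord₁₁ F (o F)` of every guarded family give `S_N16Holder β (RRec₁₃On 𝔯 Rg)` (dag-n16-c's
(E2) closer once per family). [folklore] -/
theorem s_N16Holder_rRec₁₃On_of_constLayer_leafSlotHolder
    (hpin : ∀ (F : T4Family) (θ : Stage13Params F N) (hP : θ.Provisos₁₃ F N) (g₀ : ℕ → ℝ) (os : List (ULoop F)) (k : ℕ), (𝔯.lit F θ hP g₀ os).ne3 k = o F)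
    (h : ∀ (F : T4Family), (∃ θ : Stage13Params F N, θ.Provisos₁₃ F N ∧ Rg F θ ∧ θ.Admissible F N) →
      InEndRegimeH (ne3OfRecord₁₁ F (o F)) ∧ LeafSlotHolder (ne3OfRecord₁₁ F (o F)) β) :
    S_N16Holder β (RRec₁₃On 𝔯 Rg) :=
  (s_N16Holder_rRec₁₃On_iff_of_constLayer β 𝔯 Rg o hpin).2 fun F hF => n16HolderAt_of_inEndRegimeH_leafSlotHolder (h F hF).1 hβ0 hβ1 (h F hF).2

/-- **THE KNIT AT A CONSTANT LAYER, HOLDER LEAF FORM, CANONICAL HOME** (`0 ≤ β ≤ 1`). [folklore] -/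
theorem s_N16Holder_rRec₁₃_of_constLayer_leafSlotHolder
    (hpin : ∀ (F : T4Family) (θ : Stage13Params F N) (hP : θ.Provisos₁₃ F N) (g₀ : ℕ → ℝ) (os : List (ULoop F)) (k : ℕ), (𝔯.lit F θ hP g₀ os).ne3 k = o F)
    (h : ∀ (F : T4Family), (∃ D : Datum F N, IsDatumOfRecord₁₃C F N D) → InEndRegimeH (ne3OfRecord₁₁ F (o F)) ∧ LeafSlotHolder (ne3OfRecord₁₁ F (o F)) β) :
    S_N16Holder β (RRec₁₃ 𝔯) :=
  (s_N16Holder_rRec₁₃_iff_of_constLayer β 𝔯 o hpin).2 fun F hF => n16HolderAt_of_inEndRegimeH_leafSlotHolder (h F hF).1 hβ0 hβ1 (h F hF).2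

end ConstLayerLeaf

/-! ## §3 `S_N16Holder β` at RR-1's NE3 object of record (`hpin`-generic: at the named Stage-13 reading of record `hpin := fun … => rfl`) -/

section OfRecord

variable (ℓ : T4Family → NE3Letters₁₁)
  (hpin : ∀ (F : T4Family) (θ : Stage13Params F N) (hP : θ.Provisos₁₃ F N) (g₀ : ℕ → ℝ) (os : List (ULoop F)) (k : ℕ),
    (𝔯.lit F θ hP g₀ os).ne3 k = ne3ConstLayerOfRecord₁₁ F N (ℓ F))
include hpin

/-- **`S_N16Holder β` AT THE OBJECT OF RECORD, REGIME-RESTRICTED HOME** IS «`N16HolderAt (ne3OfRecord₁₁ F (ne3ConstLayerOfRecord₁₁ F N (ℓ F))) β` for every family carrying an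
admissible Stage-13 tuple with provisos in `Rg`». [folklore] -/
theorem s_N16Holder_rRec₁₃On_iff_ofRecord :
    S_N16Holder β (RRec₁₃On 𝔯 Rg) ↔ ∀ (F : T4Family), (∃ θ : Stage13Params F N, θ.Provisos₁₃ F N ∧ Rg F θ ∧ θ.Admissible F N) →
      N16HolderAt (ne3OfRecord₁₁ F (ne3ConstLayerOfRecord₁₁ F N (ℓ F))) β :=
  s_N16Holder_rRec₁₃On_iff_of_constLayer β 𝔯 Rg (fun F => ne3ConstLayerOfRecord₁₁ F N (ℓ F)) hpin

/-- **THE `h16` READ-OUT AT THE OBJECT OF RECORD, REGIME-RESTRICTED**. [folklore] -/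
theorem n16HolderAt_of_s_N16Holder_rRec₁₃On_ofRecord (hS : S_N16Holder β (RRec₁₃On 𝔯 Rg)) (F : T4Family) {θ : Stage13Params F N} (hP : θ.Provisos₁₃ F N)
    (hRg : Rg F θ) (hθ : θ.Admissible F N) : N16HolderAt (ne3OfRecord₁₁ F (ne3ConstLayerOfRecord₁₁ F N (ℓ F))) β :=
  (s_N16Holder_rRec₁₃On_iff_ofRecord β 𝔯 Rg ℓ hpin).1 hS F ⟨θ, hP, hRg, hθ⟩

/-- **N21's FACE AT EXPONENT `β` AT THE OBJECT OF RECORD, REGIME-RESTRICTED**: under the candidate stub, at every guarded family the β-root `CovRootHolder` at RR-1's period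
`ne3NperOfRecord₁₁ F 0 0 = 2·L^m`, the letters `ℓ F` and the data of record `ne3DomOfRecord₁₁ F N 0 0` (`N16HolderAt` unfolded — what dag-n21-d's `…N21HolderWidth` reads at ₁₃).
[folklore] -/
theorem covRootHolder_rRec₁₃On_ofRecord (hS : S_N16Holder β (RRec₁₃On 𝔯 Rg)) (F : T4Family) {θ : Stage13Params F N} (hP : θ.Provisos₁₃ F N) (hRg : Rg F θ)
    (hθ : θ.Admissible F N) :
    CovRootHolder 4 (sfClass 4 (ne3LOfRecord₁₁ F) (ne3NperOfRecord₁₁ F 0 0) (ℓ F).ε) (ne3LOfRecord₁₁ F) (ne3NperOfRecord₁₁ F 0 0) (ℓ F).b (ℓ F).g (ℓ F).C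
      (ℓ F).Λ₁ (ℓ F).Λ₂' β (ne3DomOfRecord₁₁ F N 0 0) :=
  n16HolderAt_of_s_N16Holder_rRec₁₃On_ofRecord β 𝔯 Rg ℓ hpin hS F hP hRg hθ

/-- **THE TWO HOMES AGREE AT THE OBJECT OF RECORD — CANONICAL ⇒ REGIME-RESTRICTED, EVERY REGIME**: a guarded family carries the datum of record `datumOfRecord₁₃ F N θ hP`, so the
canonical home's sentence covers it. [folklore] -/
theorem s_N16Holder_rRec₁₃On_ofRecord_of_rRec₁₃ (hS : S_N16Holder β (RRec₁₃ 𝔯)) : S_N16Holder β (RRec₁₃On 𝔯 Rg) :=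
  (s_N16Holder_rRec₁₃On_iff_ofRecord β 𝔯 Rg ℓ hpin).2 fun F ⟨θ, hP, _, hθ⟩ =>
    (s_N16Holder_rRec₁₃_iff_of_constLayer β 𝔯 (fun F => ne3ConstLayerOfRecord₁₁ F N (ℓ F)) hpin).1 hS F
      ⟨_, Node00.isDatumOfRecord₁₃C_datumOfRecord₁₃ F N θ hP hθ⟩

/-- **THE `β ≤ 1` WEAKENING AT THE OBJECT OF RECORD, REGIME-RESTRICTED**: `S_N16 → S_N16Holder β` for `β ≤ 1` whenever the letters carry a non-negative Hölder letter
`0 ≤ (ℓ F).Λ₂'`. [folklore] -/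
theorem s_N16Holder_rRec₁₃On_ofRecord_of_s_N16 (hβ : β ≤ 1) (hΛ : ∀ F : T4Family, 0 ≤ (ℓ F).Λ₂') (hS : S_N16 (RRec₁₃On 𝔯 Rg)) :
    S_N16Holder β (RRec₁₃On 𝔯 Rg) :=
  s_N16Holder_rRec₁₃On_of_s_N16 β 𝔯 Rg hβ (fun F θ hP g₀ os k => by rw [hpin F θ hP g₀ os k]; exact hΛ F) hS

end OfRecord

/-! ## §4 ★ THE N16 LINE AT THE STAGE-13 HOMES, LINEAR CURRENCY (β = 1: the stub of record `S_N16`) -/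

section LineOfRecord

variable (ℓ : T4Family → NE3Letters₁₁)
  (hpin : ∀ (F : T4Family) (θ : Stage13Params F N) (hP : θ.Provisos₁₃ F N) (g₀ : ℕ → ℝ) (os : List (ULoop F)) (k : ℕ),
    (𝔯.lit F θ hP g₀ os).ne3 k = ne3ConstLayerOfRecord₁₁ F N (ℓ F))
  -- N05's constants, per family; the averaging letter in N05's window and N07's leaf letters, per family
  {len : T4Family → Site 4 → ℝ} {c₁ c₁' B₁' cP C₂ B₀β : T4Family → ℝ} {inp : T4Family → B8.B9Inputs} {α b' c' : T4Family → ℝ}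
  (hlen : ∀ (F : T4Family) (v : Site 4), 0 < len F v → 1 ≤ len F v) (hlen1 : ∀ (F : T4Family) (μ : Fin 4), len F (e μ) = 1)
  (hB₁' : ∀ F, 0 < B₁' F) (hBB : ∀ F : T4Family, 5 * ((4 : ℕ) : ℝ) * F.L * (inp F).B₀ ≤ B₁' F) (hc₁' : ∀ F, 0 < c₁' F)
  (hwin : ∀ (F : T4Family) (α₀ α₁ : ℝ), 0 < α₀ → 0 < α₁ → α₀ + α₁ ≤ c₁' F →
    α₀ + α₁ ≤ c₁ F ∧ C0 4 * (2 * α₀) ≤ 1 / 3 ∧ 4 * α₀ ≤ c2' 4 F.L ∧ 16 * (B₁' F * (α₀ + α₁)) ≤ 1 ∧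
    Real.exp (4 * (800 * (((4 : ℕ) : ℝ) + 1) ^ 2 * (((4 : ℕ) : ℝ) + 4)) * α₀) * (1 + 8 * (131072 * (((4 : ℕ) : ℝ) + 1) ^ 2) * (B₁' F * (α₀ + α₁))) ≤ 2 ∧
    2 * (B₁' F * (α₀ + α₁)) ≤ c3 4 F.L ∧ ((4 : ℕ) : ℝ) * F.L * α₁ ≤ 1 / 8 ∧ α₀ ≤ cP F ∧ α₁ ≤ cP F ∧ B₁' F * (α₀ + α₁) ≤ cP F ∧
    2 * (B₁' F * (α₀ + α₁)) ^ 2 + 20 * ((4 : ℕ) : ℝ) * α₀ * (B₁' F * (α₀ + α₁)) + 2 * C₂ F * (B₁' F * (α₀ + α₁)) ^ 2 ≤ α₀ + α₁)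
  (hα : ∀ F, 0 < α F) (hα1 : ∀ F, α F ≤ c₁' F / 177)
  (hα2 : ∀ F : T4Family, α F ≤ (ℓ F).Λ₁ / (1770 * (5 * ((4 : ℕ) : ℝ) * F.L * (inp F).B₀) + 1))
  (hα3 : ∀ F : T4Family, α F ≤ c2' 4 F.L / 2)
  (hα4 : ∀ F : T4Family, α F ≤ 1 / ((23040 * (4 : ℝ) ^ 4 * (frameC 4 F.L + 4) ^ 3 + 12) * (1 + curConst 4 F.L) + 1))
  (hα5 : ∀ F, α F ≤ 1 / 10 ^ 9)
  (hg : ∀ F, 0 < (ℓ F).g) (hε0 : ∀ F, 0 < (ℓ F).ε) (hε : ∀ F, (ℓ F).ε < α F)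
  (hΛ₁r : ∀ F : T4Family, (ℓ F).Λ₁ ≤ radiusOfRecord N F.L (ne3NperOfRecord₁₁ F 0 0))
  (hb : ∀ F, 0 ≤ (ℓ F).b ∧ (ℓ F).b ≤ (ℓ F).ε / 2) (hC : ∀ F : T4Family, constOfRecord N F.L (ne3NperOfRecord₁₁ F 0 0) (ℓ F).g ≤ (ℓ F).C)
  (hΛ₂' : ∀ F : T4Family, 177 * α F * (5 * ((4 : ℕ) : ℝ) * F.L * B₀β F + 5 * ((4 : ℕ) : ℝ) * F.L * (inp F).B₀) ≤ (ℓ F).Λ₂')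
  (hb' : ∀ F, 0 ≤ b' F ∧ b' F ≤ α F / 2048) (hc' : ∀ F, 0 ≤ c' F ∧ c' F ≤ α F / 24)
include hpin hlen hlen1 hB₁' hBB hc₁' hwin hα hα1 hα2 hα3 hα4 hα5 hg hε0 hε hΛ₁r hb hC hΛ₂' hb' hc'

/-- **THE N16 LINE AT THE REGIME-RESTRICTED STAGE-13 HOME, LINEAR CURRENCY** — for a reading pinned at RR-1's object of record with windowed letters `ℓ F`, the three content
clauses (N05's `Thm4Body` ∕ `Prop3Body` on the univ sub-family of `zdGF3 (M_N ℂ) F.L 1 (len F)`, N07's `LeafH3sup` at `(ℓ F).ε, b' F, c' F`) ONCE per guarded family give the K3‴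
composer's `h16 : S_N16 (RRec₁₃On 𝔯 Rg)`; every other hypothesis is a displayed letter line (file 17's STAGE-FREE `inEndRegime_and_leafSlot_ofRecord_of_window_linear` per family,
module 19's `s_N16_rRec₁₃On_ofRecord_of_leafSlot`). [folklore] -/
theorem s_N16_rRec₁₃On_ofRecord_of_window_linear
    (hcontent : ∀ (F : T4Family), (∃ θ : Stage13Params F N, θ.Provisos₁₃ F N ∧ Rg F θ ∧ θ.Admissible F N) →
      letI : CStarAlgebra (Matrix (Fin N) (Fin N) ℂ) := {}
      B8.Thm4Body (c₁ F) (B₁' F) (fun i : {i : ZdIdx 4 F.L // i.Ω 0 = Set.univ} => (zdGF3 (Matrix (Fin N) (Fin N) ℂ) F.L 1 (len F) i.1).toGFData) ∧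
        B8.Prop3Body (cP F) 4 (F.L : ℝ) (C₂ F) (inp F) (B₀β F)
          (fun i : {i : ZdIdx 4 F.L // i.Ω 0 = Set.univ} => (zdGF3 (Matrix (Fin N) (Fin N) ℂ) F.L 1 (len F) i.1).toGFData2) ∧
        LeafH3sup 4 F.L (ne3NperOfRecord₁₁ F 0 0) (ℓ F).ε (b' F) (c' F) (ne3DomOfRecord₁₁ F N 0 0)) :
    S_N16 (RRec₁₃On 𝔯 Rg) :=
  s_N16_rRec₁₃On_ofRecord_of_leafSlot 𝔯 Rg ℓ hpin fun F hF =>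
    inEndRegime_and_leafSlot_ofRecord_of_window_linear ℓ hlen hlen1 hB₁' hBB hc₁' hwin hα hα1 hα2 hα3 hα4 hα5 hg hε0 hε hΛ₁r hb hC hΛ₂' hb' hc' F
      (hcontent F hF).1 (hcontent F hF).2.1 (hcontent F hF).2.2

/-- **THE N16 LINE AT THE CANONICAL STAGE-13 HOME `RRec₁₃ 𝔯`, LINEAR CURRENCY** (content once per family carrying a Stage-13 datum of record; dag-n21-d's `h16` at ₁₃).
[folklore] -/
theorem s_N16_rRec₁₃_ofRecord_of_window_linear
    (hcontent : ∀ (F : T4Family), (∃ D : Datum F N, IsDatumOfRecord₁₃C F N D) →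
      letI : CStarAlgebra (Matrix (Fin N) (Fin N) ℂ) := {}
      B8.Thm4Body (c₁ F) (B₁' F) (fun i : {i : ZdIdx 4 F.L // i.Ω 0 = Set.univ} => (zdGF3 (Matrix (Fin N) (Fin N) ℂ) F.L 1 (len F) i.1).toGFData) ∧
        B8.Prop3Body (cP F) 4 (F.L : ℝ) (C₂ F) (inp F) (B₀β F)
          (fun i : {i : ZdIdx 4 F.L // i.Ω 0 = Set.univ} => (zdGF3 (Matrix (Fin N) (Fin N) ℂ) F.L 1 (len F) i.1).toGFData2) ∧
        LeafH3sup 4 F.L (ne3NperOfRecord₁₁ F 0 0) (ℓ F).ε (b' F) (c' F) (ne3DomOfRecord₁₁ F N 0 0)) :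
    S_N16 (RRec₁₃ 𝔯) :=
  s_N16_rRec₁₃_of_constLayer_leafSlot 𝔯 (fun F => ne3ConstLayerOfRecord₁₁ F N (ℓ F)) hpin fun F hF =>
    inEndRegime_and_leafSlot_ofRecord_of_window_linear ℓ hlen hlen1 hB₁' hBB hc₁' hwin hα hα1 hα2 hα3 hα4 hα5 hg hε0 hε hΛ₁r hb hC hΛ₂' hb' hc' F
      (hcontent F hF).1 (hcontent F hF).2.1 (hcontent F hF).2.2

end LineOfRecord

/-! ## §5 ★ THE N16 LINE AT THE STAGE-13 HOMES AT A PRINTED HÖLDER EXPONENT `β ∈ [0, 1]` (`S_N16Holder β`, dag-n16-c's β-kit) -/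

section HolderLineOfRecord

variable (hβ0 : 0 ≤ β) (hβ1 : β ≤ 1) (ℓ : T4Family → NE3Letters₁₁)
  (hpin : ∀ (F : T4Family) (θ : Stage13Params F N) (hP : θ.Provisos₁₃ F N) (g₀ : ℕ → ℝ) (os : List (ULoop F)) (k : ℕ),
    (𝔯.lit F θ hP g₀ os).ne3 k = ne3ConstLayerOfRecord₁₁ F N (ℓ F))
  {len : T4Family → Site 4 → ℝ} {c₁ c₁' B₁' cP C₂ B₀β : T4Family → ℝ} {inp : T4Family → B8.B9Inputs} {α b' c' : T4Family → ℝ}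
  (hlen : ∀ (F : T4Family) (v : Site 4), 0 < len F v → 1 ≤ len F v) (hlen1 : ∀ (F : T4Family) (μ : Fin 4), len F (e μ) = 1)
  (hB₁' : ∀ F, 0 < B₁' F) (hBB : ∀ F : T4Family, 5 * ((4 : ℕ) : ℝ) * F.L * (inp F).B₀ ≤ B₁' F) (hc₁' : ∀ F, 0 < c₁' F)
  (hwin : ∀ (F : T4Family) (α₀ α₁ : ℝ), 0 < α₀ → 0 < α₁ → α₀ + α₁ ≤ c₁' F →
    α₀ + α₁ ≤ c₁ F ∧ C0 4 * (2 * α₀) ≤ 1 / 3 ∧ 4 * α₀ ≤ c2' 4 F.L ∧ 16 * (B₁' F * (α₀ + α₁)) ≤ 1 ∧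
    Real.exp (4 * (800 * (((4 : ℕ) : ℝ) + 1) ^ 2 * (((4 : ℕ) : ℝ) + 4)) * α₀) * (1 + 8 * (131072 * (((4 : ℕ) : ℝ) + 1) ^ 2) * (B₁' F * (α₀ + α₁))) ≤ 2 ∧
    2 * (B₁' F * (α₀ + α₁)) ≤ c3 4 F.L ∧ ((4 : ℕ) : ℝ) * F.L * α₁ ≤ 1 / 8 ∧ α₀ ≤ cP F ∧ α₁ ≤ cP F ∧ B₁' F * (α₀ + α₁) ≤ cP F ∧
    2 * (B₁' F * (α₀ + α₁)) ^ 2 + 20 * ((4 : ℕ) : ℝ) * α₀ * (B₁' F * (α₀ + α₁)) + 2 * C₂ F * (B₁' F * (α₀ + α₁)) ^ 2 ≤ α₀ + α₁)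
  (hα : ∀ F, 0 < α F) (hα1 : ∀ F, α F ≤ c₁' F / 177)
  (hα2 : ∀ F : T4Family, α F ≤ (ℓ F).Λ₁ / (1770 * (5 * ((4 : ℕ) : ℝ) * F.L * (inp F).B₀) + 1))
  (hα3 : ∀ F : T4Family, α F ≤ c2' 4 F.L / 2)
  (hα4 : ∀ F : T4Family, α F ≤ 1 / ((23040 * (4 : ℝ) ^ 4 * (frameC 4 F.L + 4) ^ 3 + 12) * (1 + curConst 4 F.L) + 1))
  (hα5 : ∀ F, α F ≤ 1 / 10 ^ 9)
  (hg : ∀ F, 0 < (ℓ F).g) (hε0 : ∀ F, 0 < (ℓ F).ε) (hε : ∀ F, (ℓ F).ε < α F)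
  (hΛ₁r : ∀ F : T4Family, (ℓ F).Λ₁ ≤ radiusOfRecordH N F.L (ne3NperOfRecord₁₁ F 0 0))
  (hb : ∀ F, 0 ≤ (ℓ F).b ∧ (ℓ F).b ≤ (ℓ F).ε / 2) (hC : ∀ F : T4Family, constOfRecordH N F.L (ne3NperOfRecord₁₁ F 0 0) (ℓ F).g ≤ (ℓ F).C)
  (hΛ₂' : ∀ F : T4Family, 177 * α F * (5 * ((4 : ℕ) : ℝ) * F.L * B₀β F + 5 * ((4 : ℕ) : ℝ) * F.L * (inp F).B₀) ≤ (ℓ F).Λ₂')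
  (hb' : ∀ F, 0 ≤ b' F ∧ b' F ≤ α F / 2048) (hc' : ∀ F, 0 ≤ c' F ∧ c' F ≤ α F / 24)
include hβ0 hβ1 hpin hlen hlen1 hB₁' hBB hc₁' hwin hα hα1 hα2 hα3 hα4 hα5 hg hε0 hε hΛ₁r hb hC hΛ₂' hb' hc'

/-- **THE N16 LINE AT EXPONENT `β ∈ [0, 1]` AT THE REGIME-RESTRICTED STAGE-13 HOME, LINEAR CURRENCY** — N05's family at `zdGF3 (M_N ℂ) F.L β (len F)`, (E1)'s β-uniform
thresholds `radiusOfRecordH` ∕ `constOfRecordH`, N07's leaf letters linear; the three content clauses once per guarded family give `S_N16Holder β (RRec₁₃On 𝔯 Rg)` (file 18's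
STAGE-FREE `inEndRegimeH_and_leafSlotHolder_ofRecord_of_window_linear` per family, §2b's closer). [folklore] -/
theorem s_N16Holder_rRec₁₃On_ofRecord_of_window_linear
    (hcontent : ∀ (F : T4Family), (∃ θ : Stage13Params F N, θ.Provisos₁₃ F N ∧ Rg F θ ∧ θ.Admissible F N) →
      letI : CStarAlgebra (Matrix (Fin N) (Fin N) ℂ) := {}
      B8.Thm4Body (c₁ F) (B₁' F) (fun i : {i : ZdIdx 4 F.L // i.Ω 0 = Set.univ} => (zdGF3 (Matrix (Fin N) (Fin N) ℂ) F.L β (len F) i.1).toGFData) ∧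
        B8.Prop3Body (cP F) 4 (F.L : ℝ) (C₂ F) (inp F) (B₀β F)
          (fun i : {i : ZdIdx 4 F.L // i.Ω 0 = Set.univ} => (zdGF3 (Matrix (Fin N) (Fin N) ℂ) F.L β (len F) i.1).toGFData2) ∧
        LeafH3sup 4 F.L (ne3NperOfRecord₁₁ F 0 0) (ℓ F).ε (b' F) (c' F) (ne3DomOfRecord₁₁ F N 0 0)) :
    S_N16Holder β (RRec₁₃On 𝔯 Rg) :=
  s_N16Holder_rRec₁₃On_of_constLayer_leafSlotHolder β 𝔯 Rg hβ0 hβ1 (fun F => ne3ConstLayerOfRecord₁₁ F N (ℓ F)) hpin fun F hF =>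
    inEndRegimeH_and_leafSlotHolder_ofRecord_of_window_linear ℓ hlen hlen1 hB₁' hBB hc₁' hwin hα hα1 hα2 hα3 hα4 hα5 hg hε0 hε hΛ₁r hb hC hΛ₂' hb' hc' F
      (hcontent F hF).1 (hcontent F hF).2.1 (hcontent F hF).2.2

/-- **THE N16 LINE AT EXPONENT `β ∈ [0, 1]` AT THE CANONICAL STAGE-13 HOME `RRec₁₃ 𝔯`, LINEAR CURRENCY** (content once per family carrying a Stage-13 datum of record).
[folklore] -/
theorem s_N16Holder_rRec₁₃_ofRecord_of_window_linear
    (hcontent : ∀ (F : T4Family), (∃ D : Datum F N, IsDatumOfRecord₁₃C F N D) →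
      letI : CStarAlgebra (Matrix (Fin N) (Fin N) ℂ) := {}
      B8.Thm4Body (c₁ F) (B₁' F) (fun i : {i : ZdIdx 4 F.L // i.Ω 0 = Set.univ} => (zdGF3 (Matrix (Fin N) (Fin N) ℂ) F.L β (len F) i.1).toGFData) ∧
        B8.Prop3Body (cP F) 4 (F.L : ℝ) (C₂ F) (inp F) (B₀β F)
          (fun i : {i : ZdIdx 4 F.L // i.Ω 0 = Set.univ} => (zdGF3 (Matrix (Fin N) (Fin N) ℂ) F.L β (len F) i.1).toGFData2) ∧
        LeafH3sup 4 F.L (ne3NperOfRecord₁₁ F 0 0) (ℓ F).ε (b' F) (c' F) (ne3DomOfRecord₁₁ F N 0 0)) :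
    S_N16Holder β (RRec₁₃ 𝔯) :=
  s_N16Holder_rRec₁₃_of_constLayer_leafSlotHolder β 𝔯 hβ0 hβ1 (fun F => ne3ConstLayerOfRecord₁₁ F N (ℓ F)) hpin fun F hF =>
    inEndRegimeH_and_leafSlotHolder_ofRecord_of_window_linear ℓ hlen hlen1 hB₁' hBB hc₁' hwin hα hα1 hα2 hα3 hα4 hα5 hg hε0 hε hΛ₁r hb hC hΛ₂' hb' hc' F
      (hcontent F hF).1 (hcontent F hF).2.1 (hcontent F hF).2.2

end HolderLineOfRecord

end

end Summit.QuantumFields.YangMills.BalabanUVNodes.N16AtRRec13Lines
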